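import Mathlib
import HarnessLib
import Summits.ResolutionOfSingularities.ResolutionOfSingularities.Theorems.WildQuotientsWildQuotientResolutionS1aReesBigrading
import Summits.ResolutionOfSingularities.ResolutionOfSingularities.Theorems.WildQuotientsWildQuotientResolutionS1aCoarseChart
import Literature.AlgebraicGeometry.Resolution.AffineBlowup

/-!
# S1a — VERONESE TRANSFER of the cover relation: from `R^w` to the Rees algebra `Rees_{𝒜 0}(K d̄)`

[OURS · L1 W4.5c · lead-1 g6] — NOT a statement of the manuscript; counted 0; AI-level work, weaker than expert
review. Crux stmt-ResolutionOfSingularities-17941 (`WildQuotients.CyclicQuotientFourfolds`), line `s1a-logminvertex`,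
stub `stub_localGame` (producer); A5b design memo `Cruxes/CyclicQuotientFourfolds/Lines/s1a-logminvertex-A5B-DESIGN.md`
(N2). The normalised cover of `…S1aCoverNormalisation` says: every `fᵢ T^{wᵢ}` lies in the radical of the ideal of
`R^w` spanned by the cover elements `y_j T^{d̄}` (`y_j ∈ K d̄`). For the scheme glue ((S2): the charts `D₊(y_j t)` COVER
the blow-up `Bl_{K d̄}(Spec 𝒜₀) = Proj Rees_{𝒜0}(K d̄)`) one needs the same statement INSIDE the Rees algebra of the
ideal `K d̄` of `𝒜 0` (tree `AffineBlowup.lean`: `reesT`, `reesAlgebra`): for every `x ∈ K d̄`,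
`x t ∈ √(span {y_j t})`. This file proves it when `d̄` is a VERONESE degree ((G1a), `…S1aVeroneseNormalisation`):

* `C_prod_mul_T_mem_radical` — a weighted monomial `f^α` of weight `≥ d̄ > 0`, placed in degree `d̄`, is a multiple of
  some `fᵢ T^{wᵢ}` in `R^w`, hence lies in the radical;
* `coverElement_mem_radical` — hence so does every `x T^{d̄}`, `x ∈ K d̄` (span induction over `𝒥_{d̄}`);
* **`reesT_mem_radical_span`** — reading a relation `(x T^{d̄})^{M+1} = Σ g_j · y_j T^{d̄}` in `T`-degree
  `(M+1) d̄` and `𝒜`-degree `0` (`ReesBigrading.component`) gives `x^{M+1} = Σ z_j y_j` with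
  `z_j ∈ K (M d̄) = (K d̄)^M` (VERONESE), i.e. `(x t)^{M+1} = Σ (z_j t^M)(y_j t)` in `Rees_{𝒜0}(K d̄)`.
-/

set_option linter.dupNamespace false

noncomputable section

open Polynomial Literature.AlgebraicGeometry.Resolution
open scoped LaurentPolynomial
open Summit.ResolutionOfSingularities.ResolutionOfSingularities.Theorems.WildQuotientResolution.S1.ReesBigrading

namespace Summit.ResolutionOfSingularities.ResolutionOfSingularities.Theorems.WildQuotientResolution.S1.CoarseChart

universe u v

variable {ι : Type v} [AddCommGroup ι] [DecidableEq ι] {B : Type u} [CommRing B]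
  (𝒜 : ι → AddSubgroup B) [GradedRing 𝒜] {c : ℕ} (f : Fin c → B) (w : Fin c → ℕ)
  (dbar : ℕ) {L : ℕ} (y : Fin L → ↥(𝒜 0)) (hy : ∀ j, y j ∈ (traceFiltration 𝒜 f w).ideal dbar)

/-! ## Every `x T^{d̄}`, `x ∈ 𝒥_{d̄}`, lies in the radical -/

omit [GradedRing 𝒜] in
/-- A weighted monomial of weight `≥ d̄ > 0`, placed in `T`-degree `d̄`, is `s^{wt α − d̄} · ∏ (fᵢ T^{wᵢ})^{αᵢ}`; some
`αᵢ > 0`, so it lies in any radical ideal containing all `fᵢ T^{wᵢ}`. -/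
theorem C_prod_mul_T_mem_radical (hd : 0 < dbar) (I : Ideal ↥(cobordantAlgebra f w))
    (hcov : ∀ i : Fin c, cobordantAlgebra.u' f w i ∈ I.radical) (α : Fin c →₀ ℕ) (hα : dbar ≤ Finsupp.weight w α) :
    ∃ hmem : LaurentPolynomial.C (α.prod fun i e => f i ^ e) * LaurentPolynomial.T (dbar : ℤ) ∈ cobordantAlgebra f w,
      (⟨_, hmem⟩ : ↥(cobordantAlgebra f w)) ∈ I.radical := by
  classical
  -- the element `s^{wt α − d̄} · ∏ u'ᵢ^{αᵢ}` of `R^w`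
  set z : ↥(cobordantAlgebra f w) :=
    cobordantAlgebra.s f w ^ (Finsupp.weight w α - dbar) * α.prod fun i e => cobordantAlgebra.u' f w i ^ e with hz
  have hzcoe : (z : B[T;T⁻¹]) = LaurentPolynomial.C (α.prod fun i e => f i ^ e) * LaurentPolynomial.T (dbar : ℤ) := by
    rw [hz, MulMemClass.coe_mul, cobordantAlgebra.coe_s_pow, coe_prod_u'_pow, mul_left_comm, ← LaurentPolynomial.T_add]
    congr 2
    push_cast [Nat.cast_sub hα]
    ring
  refine ⟨hzcoe ▸ z.2, ?_⟩
  have hzeq : (⟨_, hzcoe ▸ z.2⟩ : ↥(cobordantAlgebra f w)) = z := Subtype.ext hzcoe.symm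
  rw [hzeq, hz]
  -- some exponent is positive
  have hne : α ≠ 0 := by
    rintro rfl
    simp at hα
    omega
  obtain ⟨i, hi⟩ := Finsupp.ne_iff.mp hne
  simp only [Finsupp.coe_zero, Pi.zero_apply] at hi
  refine Ideal.mul_mem_left _ _ ?_
  rw [Finsupp.prod, ← Finset.mul_prod_erase _ _ (Finsupp.mem_support_iff.mpr hi)]
  exact Ideal.mul_mem_right _ _ (Ideal.pow_mem_of_mem _ (hcov i) _ (Nat.pos_of_ne_zero hi))

/-- **Every `x T^{d̄}` with `x ∈ 𝒥_{d̄}` lies in the radical** of an ideal of `R^w` whose radical contains all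
`fᵢ T^{wᵢ}` (`0 < d̄`). [OURS · L1 W4.5c] -/
theorem C_mul_T_mem_radical (hd : 0 < dbar) (I : Ideal ↥(cobordantAlgebra f w))
    (hcov : ∀ i : Fin c, cobordantAlgebra.u' f w i ∈ I.radical) {x : B}
    (hx : x ∈ (weightedFiltration f w).ideal dbar) :
    ∃ hmem : LaurentPolynomial.C x * LaurentPolynomial.T (dbar : ℤ) ∈ cobordantAlgebra f w,
      (⟨_, hmem⟩ : ↥(cobordantAlgebra f w)) ∈ I.radical := by
  rw [weightedFiltration_ideal] at hx
  refine Submodule.span_induction ?_ ?_ ?_ ?_ hx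
  · rintro m ⟨α, hα, rfl⟩
    exact C_prod_mul_T_mem_radical f w dbar hd I hcov α hα
  · exact ⟨by rw [map_zero, zero_mul]; exact zero_mem _, by
      have : (⟨LaurentPolynomial.C (0 : B) * LaurentPolynomial.T (dbar : ℤ), by
          rw [map_zero, zero_mul]; exact zero_mem _⟩ : ↥(cobordantAlgebra f w)) = 0 :=
        Subtype.ext (show LaurentPolynomial.C (0 : B) * LaurentPolynomial.T (dbar : ℤ) =
          ((0 : ↥(cobordantAlgebra f w)) : B[T;T⁻¹]) by rw [map_zero, zero_mul, ZeroMemClass.coe_zero])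
      rw [this]; exact zero_mem _⟩
  · rintro a b - - ⟨ha, ha'⟩ ⟨hb, hb'⟩
    refine ⟨by rw [map_add, add_mul]; exact add_mem ha hb, ?_⟩
    have : (⟨LaurentPolynomial.C (a + b) * LaurentPolynomial.T (dbar : ℤ), by
        rw [map_add, add_mul]; exact add_mem ha hb⟩ : ↥(cobordantAlgebra f w)) = ⟨_, ha⟩ + ⟨_, hb⟩ :=
      Subtype.ext (show LaurentPolynomial.C (a + b) * LaurentPolynomial.T (dbar : ℤ) =
        LaurentPolynomial.C a * LaurentPolynomial.T (dbar : ℤ) + LaurentPolynomial.C b * LaurentPolynomial.T (dbar : ℤ) by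
          rw [map_add, add_mul])
    rw [this]; exact add_mem ha' hb'
  · rintro r a - ⟨ha, ha'⟩
    refine ⟨by rw [smul_eq_mul, map_mul, mul_assoc]; exact mul_mem (by
      rw [LaurentPolynomial.C_eq_algebraMap]; exact Subalgebra.algebraMap_mem _ r) ha, ?_⟩
    have : (⟨LaurentPolynomial.C (r • a) * LaurentPolynomial.T (dbar : ℤ), by
        rw [smul_eq_mul, map_mul, mul_assoc]
        exact mul_mem (by rw [LaurentPolynomial.C_eq_algebraMap]; exact Subalgebra.algebraMap_mem _ r) ha⟩ :
          ↥(cobordantAlgebra f w)) = algebraMap B _ r * ⟨_, ha⟩ :=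
      Subtype.ext (show LaurentPolynomial.C (r • a) * LaurentPolynomial.T (dbar : ℤ) =
        ((algebraMap B (↥(cobordantAlgebra f w)) r : ↥(cobordantAlgebra f w)) : B[T;T⁻¹]) *
          (LaurentPolynomial.C a * LaurentPolynomial.T (dbar : ℤ)) by
            rw [cobordantAlgebra.coe_algebraMap, smul_eq_mul, map_mul, mul_assoc])
    rw [this]; exact Ideal.mul_mem_left _ _ ha'

/-- In particular for the cover elements' degree: `x T^{d̄} ∈ √(span {y_j T^{d̄}})` for every `x ∈ K d̄`. -/
theorem coverElement_mem_radical (hd : 0 < dbar)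
    (hcov : ∀ i : Fin c, cobordantAlgebra.u' f w i ∈
      (Ideal.span (Set.range fun j => coverElement 𝒜 f w dbar (y j) (hy j))).radical)
    (x : ↥(𝒜 0)) (hx : x ∈ (traceFiltration 𝒜 f w).ideal dbar) :
    coverElement 𝒜 f w dbar x hx ∈ (Ideal.span (Set.range fun j => coverElement 𝒜 f w dbar (y j) (hy j))).radical := by
  obtain ⟨hmem, h⟩ := C_mul_T_mem_radical f w dbar hd _ hcov ((mem_traceFiltration_iff 𝒜 f w).mp hx)
  exact h

/-! ## Transfer to the Rees algebra of `K d̄` -/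

/-- Coefficient of a product with a cover element: `(g · y T^{d̄}).coeff (m + d̄) = g.coeff m · y`. -/
theorem coeff_mul_coverElement (g : ↥(cobordantAlgebra f w)) (j : Fin L) (m : ℤ) :
    ((g * coverElement 𝒜 f w dbar (y j) (hy j) : ↥(cobordantAlgebra f w)) : B[T;T⁻¹]).coeff (m + dbar) =
      (g : B[T;T⁻¹]).coeff m * (y j : B) := by
  rw [MulMemClass.coe_mul, coe_coverElement, ← LaurentPolynomial.single_eq_C_mul_T,
    AddMonoidAlgebra.coeff_mul_single_add]

/-- **VERONESE TRANSFER.** For a homogeneous centre, a Veronese degree `d̄` and a normalised cover `(y_j)`: every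
`x t`, `x ∈ K d̄`, lies in the radical of the ideal of `Rees_{𝒜 0}(K d̄)` spanned by the `y_j t`. [OURS · L1 W4.5c] -/
theorem reesT_mem_radical_span {δ : Fin c → ι} (hf : ∀ i, f i ∈ 𝒜 (δ i)) (hver : VeroneseNormalised 𝒜 f w dbar)
    (hcov : ∀ i : Fin c, cobordantAlgebra.u' f w i ∈
      (Ideal.span (Set.range fun j => coverElement 𝒜 f w dbar (y j) (hy j))).radical)
    (x : ↥(𝒜 0)) (hx : x ∈ (traceFiltration 𝒜 f w).ideal dbar) :
    reesT x hx ∈ (Ideal.span (Set.range fun j => reesT (y j) (hy j))).radical := by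
  classical
  have hd : 0 < dbar := hver.1
  -- a relation `(x T^{d̄})^{M+1} = Σ g_j · y_j T^{d̄}` in `R^w`
  obtain ⟨M, hM⟩ := coverElement_mem_radical 𝒜 f w dbar y hy hd hcov x hx
  have hM1 : coverElement 𝒜 f w dbar x hx ^ (M + 1) ∈
      Ideal.span (Set.range fun j => coverElement 𝒜 f w dbar (y j) (hy j)) := by
    rw [pow_succ]; exact Ideal.mul_mem_right _ _ hM
  obtain ⟨g, hg⟩ := Ideal.mem_span_range_iff_exists_fun.mp hM1
  -- read it in `T`-degree `d̄ M + d̄`, `𝒜`-degree `0`: `x^{M+1} = Σ z_j y_j` with `z_j ∈ K (d̄ M) = (K d̄)^M`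
  let z : Fin L → ↥(𝒜 0) := fun j =>
    ⟨DirectSum.decompose 𝒜 (((g j : ↥(cobordantAlgebra f w)) : B[T;T⁻¹]).coeff ((dbar * M : ℕ) : ℤ)) 0,
      (DirectSum.decompose 𝒜 _ 0).2⟩
  have hz : ∀ j, z j ∈ (traceFiltration 𝒜 f w).ideal dbar ^ M := by
    intro j
    rw [← hver.2 M, mem_traceFiltration_iff]
    exact coeffMem_decompose 𝒜 f w hf (coeffMem_coeff f w (g j) _) 0 (dbar * M) rfl
  have hid : ∑ j, (z j : B) * (y j : B) = (x : B) ^ (M + 1) := by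
    have h := congrArg (component 𝒜 f w (((dbar * M : ℕ) : ℤ) + (dbar : ℤ)) (0 : ι)) hg
    rw [map_sum] at h
    have hl : ∀ j, component 𝒜 f w (((dbar * M : ℕ) : ℤ) + (dbar : ℤ)) (0 : ι)
        (g j * coverElement 𝒜 f w dbar (y j) (hy j)) = (z j : B) * (y j : B) := by
      intro j
      change (DirectSum.decompose 𝒜 _ 0 : B) = _
      rw [coeff_mul_coverElement, DirectSum.coe_decompose_mul_of_right_mem_zero 𝒜 (y j).2]
    have hr : component 𝒜 f w (((dbar * M : ℕ) : ℤ) + (dbar : ℤ)) (0 : ι)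
        (coverElement 𝒜 f w dbar x hx ^ (M + 1)) = (x : B) ^ (M + 1) := by
      refine component_eq_of_mem 𝒜 f w (x ^ (M + 1)).2 ?_
      rw [SubmonoidClass.coe_pow, coe_coverElement, mul_pow, ← map_pow, LaurentPolynomial.T_pow]
      push_cast
      ring_nf
    simp only [hl, hr] at h
    exact h
  -- hence `(x t)^{M+1} = Σ (z_j t^M)(y_j t)` in the Rees algebra of `K d̄`
  have hzmem : ∀ j, monomial M (z j) ∈ reesAlgebra ((traceFiltration 𝒜 f w).ideal dbar) := fun j =>
    reesAlgebra.monomial_mem.mpr (hz j)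
  refine ⟨M + 1, Ideal.mem_span_range_iff_exists_fun.mpr ⟨fun j => ⟨monomial M (z j), hzmem j⟩, ?_⟩⟩
  refine Subtype.ext ?_
  rw [AddSubmonoidClass.coe_finsetSum, SubmonoidClass.coe_pow, coe_reesT, monomial_pow, one_mul]
  have hid' : ∑ j, z j * y j = x ^ (M + 1) := Subtype.ext (by
    rw [AddSubmonoidClass.coe_finsetSum]; exact hid)
  rw [← hid', map_sum]
  refine Finset.sum_congr rfl fun j _ => ?_
  rw [MulMemClass.coe_mul, coe_reesT, monomial_mul_monomial]

end Summit.ResolutionOfSingularities.ResolutionOfSingularities.Theorems.WildQuotientResolution.S1.CoarseChart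

end
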